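import Summits.CriticalPhenomena.CardyFormulaZ2.Theorems.CardyIKTransportIKLinearTransportPinnedDefs
import Summits.CriticalPhenomena.CardyFormulaZ2.Theorems.CardyIKTransportIKLinearTransportStubPinnedExchange

/-!
# Stub `stub_StripDiagramExchange` — core part 1: the explicit strip model and its window law

Toward `StripDiagramExchange S i` (line `pinned-diagram-exchange`, crux stmt-CriticalPhenomena-5076). The
three-column strip of `νmix S`, re-anchored at cell column `i`, is an explicit function of independent bits (row
bits `r_y`, the column bit `c_{i+1}`, plaquette parities of the two face columns — Bernoulli `q = 2√3-3 = t/(1+t)`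
on the isotropic column, fair on the honeycomb one — and the fair diagonal coins of the isotropic column):
`ξ_y = κ₀ ⊕ r_y`, `η_y = c ⊕ r_y ⊕ Π^{(i)}_y`, `ζ_y = κ₂ ⊕ r_y ⊕ Π^{iso}_y ⊕ Π^{hc}_y` (`Π_y` = parity of the column's
plaquettes between rows `0` and `y`). This file: that model on `SDE.K = Fin 5 × ℤ → Bool` with its product law
`SDE.P`, and the WINDOW LAW `SDE.P_Wev` (a strip pattern on rows `[lo, hi] ∋ 0` is produced by one bit box).
-/

set_option autoImplicit false

noncomputable section

namespace Summit.CriticalPhenomena.CardyFormulaZ2.Theorems.IKLinearTransport.PinnedDiagramExchange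

open scoped Classical MeasureTheory ENNReal ProbabilityTheory BigOperators
open MeasureTheory Literature.Probability.Percolation Literature.Probability.LatticeModels

namespace SDE

/-! ## §1 The core bit space -/

/-- Index of the core bits: kind `0` = row bits, `1` = isotropic plaquette parities, `2` = isotropic diagonal
coins, `3` = honeycomb plaquette parities, `4` = column bits (only `(4,1)`, the bit of cell column `i+1`, is read). [folklore] -/
abbrev Idx : Type := Fin 5 × ℤ

/-- The core bit space. [folklore] -/
abbrev K : Type := Idx → Bool

/-- The plaquette density of an isotropic face column, `q = 2√3 - 3 = t/(1+t)`, `t = √3/2` (the same term as in `μIK`). [folklore] -/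
def qI : unitInterval := Set.projIcc (0:ℝ) 1 zero_le_one (2 * Real.sqrt 3 - 3)

/-- Densities of the five kinds of bits. [folklore] -/
def wt (k : Fin 5) : unitInterval := if k = 1 then qI else half

/-- The product Bernoulli law of the core bits. [folklore] -/
def P : Measure K := Measure.infinitePi (fun j : Idx => (Ber(true, false, wt j.1) : Measure Bool))

/-- `P` is a probability measure. [folklore] -/
instance isProbabilityMeasure_P : IsProbabilityMeasure P := by
  unfold P; infer_instance

/-- Numerics of `q`: `q = 2√3 - 3 ∈ (2/5, 1/2)`. [folklore] -/
theorem qI_val : (qI : ℝ) = 2 * Real.sqrt 3 - 3 ∧ (2:ℝ) / 5 < qI ∧ (qI : ℝ) < 1 / 2 := by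
  have h3 : Real.sqrt 3 * Real.sqrt 3 = 3 := Real.mul_self_sqrt (by norm_num)
  have hs : (17:ℝ) / 10 < Real.sqrt 3 := by nlinarith [Real.sqrt_nonneg 3]
  have hs' : Real.sqrt 3 < (7:ℝ) / 4 := by nlinarith [Real.sqrt_nonneg 3]
  have hmem : 2 * Real.sqrt 3 - 3 ∈ Set.Icc (0:ℝ) 1 := ⟨by linarith, by linarith⟩
  have hv : (qI : ℝ) = 2 * Real.sqrt 3 - 3 := by
    rw [qI, Set.projIcc_of_mem _ hmem]
  exact ⟨hv, by rw [hv]; linarith, by rw [hv]; linarith⟩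

/-- Singleton masses of the Bernoulli law on `Bool`. [folklore] -/
theorem ber_singleton (p : unitInterval) (t : Bool) :
    (Ber(true, false, p) : Measure Bool) {t} = ENNReal.ofReal (if t then (p : ℝ) else 1 - p) := by
  cases t
  · rw [ProbabilityTheory.bernoulliMeasure_apply_of_notMem_of_mem p (measurableSet_singleton _)
      (by simp) (by simp)]
    simp only [Bool.false_eq_true, if_false]
    rw [ENNReal.ofReal, ENNReal.coe_inj]
    apply NNReal.eq
    rw [unitInterval.coe_toNNReal, unitInterval.coe_symm_eq, Real.coe_toNNReal _ (sub_nonneg.2 p.2.2)]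
  · rw [ProbabilityTheory.bernoulliMeasure_apply_of_mem_of_notMem p (measurableSet_singleton _)
      (by simp) (by simp)]
    simp only [if_true]
    rw [ENNReal.ofReal, ENNReal.coe_inj]
    apply NNReal.eq
    rw [unitInterval.coe_toNNReal, Real.coe_toNNReal _ p.2.1]

/-- Box probabilities of the core law. [folklore] -/
theorem P_pi (S : Finset Idx) (β : Idx → Bool) :
    P (Set.pi ↑S fun j => {β j}) = ∏ j ∈ S, ENNReal.ofReal (if β j then (wt j.1 : ℝ) else 1 - wt j.1) := by
  rw [P, Measure.infinitePi_pi _ (fun j _ => measurableSet_singleton _)]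
  exact Finset.prod_congr rfl fun j _ => ber_singleton _ _

/-! ## §2 Anchored parities -/

/-- `Bool → ZMod 2`. [folklore] -/
def bz (t : Bool) : ZMod 2 := if t then 1 else 0

/-- Anchored parity of `f` over the rows between `u` and `v`. [folklore] -/
def bp (f : ℤ → Bool) (u v : ℤ) : Bool :=
  decide ((∑ s ∈ Finset.Ico (min u v) (max u v), bz (f s)) = 1)

/-- Chasles relation for anchored parities. [folklore] -/
theorem bp_chasles (f : ℤ → Bool) (u v w : ℤ) : bp f u w = (bp f u v ^^ bp f v w) := by
  have h := sum_Ico_minmax_chasles (fun s => bz (f s)) u v w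
  have fin : ∀ a b : ZMod 2, decide (a + b = 1) = (decide (a = 1) ^^ decide (b = 1)) := by decide
  unfold bp
  rw [h, fin]

/-- One-step parity. [folklore] -/
theorem bp_single (f : ℤ → Bool) (y : ℤ) : bp f y (y + 1) = f y := by
  unfold bp
  rw [min_eq_left (by omega), max_eq_right (by omega), Finset.Ico_add_one_right_eq_Icc,
    Finset.Icc_self, Finset.sum_singleton]
  cases f y <;> decide

/-- Successor rule for the parities anchored at `0`. [folklore] -/
theorem bp_succ (f : ℤ → Bool) (y : ℤ) : bp f 0 (y + 1) = (bp f 0 y ^^ f y) := by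
  rw [bp_chasles f 0 y (y + 1), bp_single]

/-- `bp f 0 0 = false`. [folklore] -/
theorem bp_zero (f : ℤ → Bool) : bp f 0 0 = false := by unfold bp; simp
/-- `bp` only reads `f` between its bounds. [folklore] -/
theorem bp_congr {f g : ℤ → Bool} {u v : ℤ} (h : ∀ s, min u v ≤ s → s < max u v → f s = g s) :
    bp f u v = bp g u v := by
  have e : ∑ s ∈ Finset.Ico (min u v) (max u v), bz (f s) = ∑ s ∈ Finset.Ico (min u v) (max u v), bz (g s) :=
    Finset.sum_congr rfl fun s hs => by rw [Finset.mem_Ico] at hs; rw [h s hs.1 hs.2]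
  unfold bp
  rw [e]

/-- TELESCOPING: if `f` is the discrete derivative of `w` on `[lo, hi) ∋ 0`, its anchored parities are
`w 0 ⊕ w y`. [folklore] -/
theorem bp_tele (f w : ℤ → Bool) (lo hi : ℤ) (hlo : lo ≤ 0) (hhi : 0 ≤ hi)
    (h : ∀ s, lo ≤ s → s < hi → f s = (w s ^^ w (s + 1))) :
    ∀ y, lo ≤ y → y ≤ hi → bp f 0 y = (w 0 ^^ w y) := by
  intro y
  induction y using Int.induction_on with
  | zero => intro _ _; rw [bp_zero]; cases w 0 <;> rfl
  | succ n ih =>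
    intro h1 h2
    rw [bp_succ, ih (by omega) (by omega), h n (by omega) (by omega)]
    cases w 0 <;> cases w n <;> cases w ((n : ℤ) + 1) <;> rfl
  | pred n ih =>
    intro h1 h2
    have e : bp f 0 (-(n : ℤ)) = (bp f 0 (-(n : ℤ) - 1) ^^ f (-(n : ℤ) - 1)) := by
      rw [← bp_succ, sub_add_cancel]
    have ih' := ih (by omega) (by omega)
    rw [e, h _ (by omega) (by omega), sub_add_cancel] at ih'
    revert ih'
    cases w 0 <;> cases w (-(n : ℤ)) <;> cases w (-(n : ℤ) - 1) <;> cases bp f 0 (-(n : ℤ) - 1) <;> decide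

/-! ## §3 The strip model read from the core bits -/

/-- Plaquette kind read at face column `i` (`τ = true`: column `i` isotropic). [folklore] -/
def kL (τ : Bool) : Fin 5 := if τ then 1 else 3
/-- Plaquette kind read at face column `i+1`. [folklore] -/
def kR (τ : Bool) : Fin 5 := if τ then 3 else 1
/-- The isotropic face column (`0` = column `i`, `1` = column `i+1`). [folklore] -/
def isoJ (τ : Bool) : Fin 2 := if τ then 0 else 1
/-- The honeycomb face column. [folklore] -/
def hcJ (τ : Bool) : Fin 2 := if τ then 1 else 0

/-- Colours of the three cell columns `i, i+1, i+2` at row `y`: `ξ_y = κ₀ ⊕ r_y`, `η_y = c ⊕ r_y ⊕ Π^{(i)}_y`,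
`ζ_y = κ₂ ⊕ r_y ⊕ Π^{iso}_y ⊕ Π^{hc}_y`. [folklore] -/
def col (τ κ₀ κ₂ : Bool) (b : K) : Fin 3 → ℤ → Bool :=
  ![fun y => κ₀ ^^ b (0, y),
    fun y => b (4, 1) ^^ b (0, y) ^^ bp (fun s => b (kL τ, s)) 0 y,
    fun y => κ₂ ^^ b (0, y) ^^ bp (fun s => b (1, s)) 0 y ^^ bp (fun s => b (3, s)) 0 y]

/-- Anti-diagonal flags of the two face columns at row `y`: a fair coin on the isotropic column, forced on
the honeycomb column. [folklore] -/
def flag (τ : Bool) (b : K) : Fin 2 → ℤ → Bool :=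
  ![fun y => if τ then b (2, y) else true, fun y => if τ then true else b (2, y)]

/-- The strip configuration as an observable configuration (cells of columns `i, i+1, i+2`; faces of columns
`i, i+1`; all other faces carry the anti-diagonal, all other cells are white — irrelevant values). [folklore] -/
def X (i : ℤ) (τ κ₀ κ₂ : Bool) (b : K) : Obs :=
  ({v | ∃ j : Fin 3, v 0 = i + j ∧ col τ κ₀ κ₂ b j (v 1) = true},
   {f | ∀ j : Fin 2, f 0 = i + j → flag τ b j (f 1) = true})

/-- The boundary colourings `(ξ, ζ)` (they do not depend on `τ`). [folklore] -/
def bdry (κ₀ κ₂ : Bool) (b : K) : (ℤ → Bool) × (ℤ → Bool) :=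
  (fun y => κ₀ ^^ b (0, y), fun y => κ₂ ^^ b (0, y) ^^ bp (fun s => b (1, s)) 0 y ^^ bp (fun s => b (3, s)) 0 y)

/-- Colour of column `i`. [folklore] -/
@[simp] theorem col_zero (τ κ₀ κ₂ : Bool) (b : K) (y : ℤ) : col τ κ₀ κ₂ b 0 y = (κ₀ ^^ b (0, y)) := rfl

/-- Colour of column `i+1`. [folklore] -/
@[simp] theorem col_one (τ κ₀ κ₂ : Bool) (b : K) (y : ℤ) :
    col τ κ₀ κ₂ b 1 y = (b (4, 1) ^^ b (0, y) ^^ bp (fun s => b (kL τ, s)) 0 y) := rfl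

/-- Colour of column `i+2`. [folklore] -/
@[simp] theorem col_two (τ κ₀ κ₂ : Bool) (b : K) (y : ℤ) :
    col τ κ₀ κ₂ b 2 y = (κ₂ ^^ b (0, y) ^^ bp (fun s => b (1, s)) 0 y ^^ bp (fun s => b (3, s)) 0 y) := rfl

/-- Flag of face column `i`. [folklore] -/
@[simp] theorem flag_zero (τ : Bool) (b : K) (y : ℤ) : flag τ b 0 y = (if τ then b (2, y) else true) := rfl

/-- Flag of face column `i+1`. [folklore] -/
@[simp] theorem flag_one (τ : Bool) (b : K) (y : ℤ) : flag τ b 1 y = (if τ then true else b (2, y)) := rfl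

/-- The boundary colourings are the columns `0` and `2` of `col`. [folklore] -/
theorem bdry_eq (τ κ₀ κ₂ : Bool) (b : K) : bdry κ₀ κ₂ b = (col τ κ₀ κ₂ b 0, col τ κ₀ κ₂ b 2) := rfl

/-- The two plaquette parities, read through `kL τ, kR τ`. [folklore] -/
theorem bp_one_three (τ : Bool) (b : K) (y : ℤ) :
    (bp (fun s => b (1, s)) 0 y ^^ bp (fun s => b (3, s)) 0 y) =
      (bp (fun s => b (kL τ, s)) 0 y ^^ bp (fun s => b (kR τ, s)) 0 y) := by
  cases τ
  · simp only [kL, kR, Bool.false_eq_true, if_false]; rw [Bool.xor_comm]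
  · simp only [kL, kR, if_true]

/-! ## §4 Windows and the window law -/

/-- Parity of the face of column `i` at row `y` in the pattern `v`. [folklore] -/
def oL (v : Fin 3 → ℤ → Bool) (y : ℤ) : Bool := v 0 y ^^ v 1 y ^^ v 0 (y + 1) ^^ v 1 (y + 1)

/-- Parity of the face of column `i+1` at row `y` in the pattern `v`. [folklore] -/
def oR (v : Fin 3 → ℤ → Bool) (y : ℤ) : Bool := v 1 y ^^ v 2 y ^^ v 1 (y + 1) ^^ v 2 (y + 1)

/-- The core bits read by the strip configuration on the rows `[lo, hi]` (faces `[lo, hi)`). [folklore] -/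
def Jw (lo hi : ℤ) : Finset Idx :=
  ({(0 : Fin 5)} ×ˢ Finset.Icc lo hi) ∪ ({((4 : Fin 5), (1 : ℤ))} ∪
    (({1, 2, 3} : Finset (Fin 5)) ×ˢ Finset.Ico lo hi))

/-- The bit pattern producing the strip pattern `(v, α)`. [folklore] -/
def bits (τ κ₀ : Bool) (v : Fin 3 → ℤ → Bool) (α : Fin 2 → ℤ → Bool) (j : Idx) : Bool :=
  if j.1 = 0 then v 0 j.2 ^^ κ₀
  else if j.1 = 4 then v 1 0 ^^ v 0 0 ^^ κ₀
  else if j.1 = kL τ then oL v j.2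
  else if j.1 = kR τ then oR v j.2
  else α (isoJ τ) j.2

/-- The window event: the strip configuration on rows `[lo, hi]` / faces `[lo, hi)` is `(v, α)`. [folklore] -/
def Wev (τ κ₀ κ₂ : Bool) (lo hi : ℤ) (v : Fin 3 → ℤ → Bool) (α : Fin 2 → ℤ → Bool) : Set K :=
  {b | (∀ j : Fin 3, ∀ y, lo ≤ y → y ≤ hi → col τ κ₀ κ₂ b j y = v j y) ∧
    (∀ j : Fin 2, ∀ y, lo ≤ y → y < hi → flag τ b j y = α j y)}


/-- Parity of the isotropic face at row `y` in the pattern `v`. [folklore] -/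
def oI (τ : Bool) (v : Fin 3 → ℤ → Bool) (y : ℤ) : Bool := if τ then oL v y else oR v y

/-- Row bits of the pattern. [folklore] -/
theorem bits_zero (τ κ₀ : Bool) (v : Fin 3 → ℤ → Bool) (α : Fin 2 → ℤ → Bool) (y : ℤ) :
    bits τ κ₀ v α (0, y) = (v 0 y ^^ κ₀) := by simp [bits]

/-- Column bit of the pattern. [folklore] -/
theorem bits_four (τ κ₀ : Bool) (v : Fin 3 → ℤ → Bool) (α : Fin 2 → ℤ → Bool) :
    bits τ κ₀ v α (4, 1) = (v 1 0 ^^ v 0 0 ^^ κ₀) := by simp [bits]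

/-- Plaquette bits of face column `i`. [folklore] -/
theorem bits_kL (τ κ₀ : Bool) (v : Fin 3 → ℤ → Bool) (α : Fin 2 → ℤ → Bool) (y : ℤ) :
    bits τ κ₀ v α (kL τ, y) = oL v y := by cases τ <;> simp [bits, kL]

/-- Plaquette bits of face column `i+1`. [folklore] -/
theorem bits_kR (τ κ₀ : Bool) (v : Fin 3 → ℤ → Bool) (α : Fin 2 → ℤ → Bool) (y : ℤ) :
    bits τ κ₀ v α (kR τ, y) = oR v y := by cases τ <;> simp [bits, kL, kR]

/-- Coin bits. [folklore] -/
theorem bits_two (τ κ₀ : Bool) (v : Fin 3 → ℤ → Bool) (α : Fin 2 → ℤ → Bool) (y : ℤ) :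
    bits τ κ₀ v α (2, y) = α (isoJ τ) y := by cases τ <;> simp [bits, kL, kR]

/-- Isotropic plaquette bits. [folklore] -/
theorem bits_one (τ κ₀ : Bool) (v : Fin 3 → ℤ → Bool) (α : Fin 2 → ℤ → Bool) (y : ℤ) :
    bits τ κ₀ v α (1, y) = oI τ v y := by cases τ <;> simp [bits, kL, kR, oI]

/-- Membership in the window index set. [folklore] -/
theorem mem_Jw (lo hi : ℤ) (k : Fin 5) (y : ℤ) : (k, y) ∈ Jw lo hi ↔
    (k = 0 ∧ lo ≤ y ∧ y ≤ hi) ∨ (k = 4 ∧ y = 1) ∨ ((k = 1 ∨ k = 2 ∨ k = 3) ∧ lo ≤ y ∧ y < hi) := by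
  simp only [Jw, Finset.mem_union, Finset.mem_product, Finset.mem_singleton, Finset.mem_Icc,
    Finset.mem_Ico, Finset.mem_insert, Prod.mk.injEq]

/-- THE WINDOW EVENT AS A BOX: on a window `[lo, hi] ∋ 0`, the strip pattern `(v, α)` is produced by exactly
one assignment of the window bits when it satisfies the anchor constraint and has anti-diagonals on the
honeycomb column, and by none otherwise. [folklore] -/
theorem Wev_eq (τ κ₀ κ₂ : Bool) {lo hi : ℤ} (hlo : lo ≤ 0) (hhi : 0 ≤ hi) (v : Fin 3 → ℤ → Bool)
    (α : Fin 2 → ℤ → Bool) :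
    Wev τ κ₀ κ₂ lo hi v α =
      if (v 0 0 ^^ v 2 0) = (κ₀ ^^ κ₂) ∧ (∀ y, lo ≤ y → y < hi → α (hcJ τ) y = true)
      then Set.pi ↑(Jw lo hi) (fun j => {bits τ κ₀ v α j}) else ∅ := by
  ext b
  simp only [Wev, Set.mem_setOf_eq]
  constructor
  · rintro ⟨hc, hf⟩
    have hr : ∀ y, lo ≤ y → y ≤ hi → b (0, y) = (v 0 y ^^ κ₀) := fun y h1 h2 => by
      have e := hc 0 y h1 h2
      rw [col_zero] at e
      revert e; cases κ₀ <;> cases b (0, y) <;> cases v 0 y <;> decide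
    have hc4 : b (4, 1) = (v 1 0 ^^ v 0 0 ^^ κ₀) := by
      have e := hc 1 0 hlo hhi
      rw [col_one, bp_zero, hr 0 hlo hhi] at e
      revert e; cases κ₀ <;> cases b (4, 1) <;> cases v 0 0 <;> cases v 1 0 <;> decide
    have hL : ∀ y, lo ≤ y → y ≤ hi →
        bp (fun s => b (kL τ, s)) 0 y = (v 1 y ^^ v 1 0 ^^ v 0 0 ^^ v 0 y) := fun y h1 h2 => by
      have e := hc 1 y h1 h2
      rw [col_one, hc4, hr y h1 h2] at e
      revert e
      cases κ₀ <;> cases v 1 0 <;> cases v 0 0 <;> cases v 0 y <;> cases v 1 y <;>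
        cases bp (fun s => b (kL τ, s)) 0 y <;> decide
    have hR : ∀ y, lo ≤ y → y ≤ hi →
        bp (fun s => b (kR τ, s)) 0 y = (v 2 y ^^ κ₂ ^^ κ₀ ^^ v 1 y ^^ v 1 0 ^^ v 0 0) := fun y h1 h2 => by
      have e := hc 2 y h1 h2
      rw [col_two, hr y h1 h2, Bool.xor_assoc (κ₂ ^^ (v 0 y ^^ κ₀)), bp_one_three τ, hL y h1 h2] at e
      revert e
      cases κ₀ <;> cases κ₂ <;> cases v 1 0 <;> cases v 0 0 <;> cases v 0 y <;> cases v 1 y <;> cases v 2 y <;>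
        cases bp (fun s => b (kR τ, s)) 0 y <;> decide
    have hbL : ∀ s, lo ≤ s → s < hi → b (kL τ, s) = oL v s := fun s h1 h2 => by
      have e := bp_succ (fun s => b (kL τ, s)) s
      rw [hL (s + 1) (by omega) (by omega), hL s h1 (by omega)] at e
      simp only [oL]
      revert e
      cases v 1 0 <;> cases v 0 0 <;> cases v 0 s <;> cases v 1 s <;> cases v 0 (s + 1) <;> cases v 1 (s + 1) <;>
        cases b (kL τ, s) <;> decide
    have hbR : ∀ s, lo ≤ s → s < hi → b (kR τ, s) = oR v s := fun s h1 h2 => by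
      have e := bp_succ (fun s => b (kR τ, s)) s
      rw [hR (s + 1) (by omega) (by omega), hR s h1 (by omega)] at e
      simp only [oR]
      revert e
      cases κ₀ <;> cases κ₂ <;> cases v 1 0 <;> cases v 0 0 <;> cases v 1 s <;> cases v 2 s <;> cases v 1 (s + 1) <;>
        cases v 2 (s + 1) <;> cases b (kR τ, s) <;> decide
    have hcoin : ∀ s, lo ≤ s → s < hi → b (2, s) = α (isoJ τ) s := fun s h1 h2 => by
      have e := hf (isoJ τ) s h1 h2
      revert e; cases τ <;> simp [isoJ]
    have hhc : ∀ s, lo ≤ s → s < hi → α (hcJ τ) s = true := fun s h1 h2 => by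
      have e := hf (hcJ τ) s h1 h2
      revert e; cases τ <;> simp [hcJ]
    have hcond : (v 0 0 ^^ v 2 0) = (κ₀ ^^ κ₂) := by
      have e := hc 2 0 hlo hhi
      rw [col_two, bp_zero, bp_zero, hr 0 hlo hhi] at e
      revert e; cases κ₀ <;> cases κ₂ <;> cases v 0 0 <;> cases v 2 0 <;> decide
    rw [if_pos ⟨hcond, hhc⟩, Set.mem_pi]
    rintro ⟨k, y⟩ hj
    rw [Finset.mem_coe, mem_Jw] at hj
    rw [Set.mem_singleton_iff]
    rcases hj with ⟨rfl, hy⟩ | ⟨rfl, rfl⟩ | ⟨hk, hy⟩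
    · rw [bits_zero]; exact hr y hy.1 hy.2
    · rw [bits_four]; exact hc4
    · rcases hk with rfl | rfl | rfl
      · cases τ
        · rw [show ((1 : Fin 5), y) = (kR false, y) from rfl, bits_kR]; exact hbR y hy.1 hy.2
        · rw [show ((1 : Fin 5), y) = (kL true, y) from rfl, bits_kL]; exact hbL y hy.1 hy.2
      · rw [bits_two]; exact hcoin y hy.1 hy.2
      · cases τ
        · rw [show ((3 : Fin 5), y) = (kL false, y) from rfl, bits_kL]; exact hbL y hy.1 hy.2
        · rw [show ((3 : Fin 5), y) = (kR true, y) from rfl, bits_kR]; exact hbR y hy.1 hy.2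
  · intro hb
    by_cases hcond : (v 0 0 ^^ v 2 0) = (κ₀ ^^ κ₂) ∧ (∀ y, lo ≤ y → y < hi → α (hcJ τ) y = true)
    swap
    · rw [if_neg hcond] at hb; exact absurd hb (Set.notMem_empty _)
    rw [if_pos hcond, Set.mem_pi] at hb
    have hB : ∀ j ∈ Jw lo hi, b j = bits τ κ₀ v α j := fun j hj =>
      Set.mem_singleton_iff.1 (hb j (Finset.mem_coe.2 hj))
    have hr : ∀ y, lo ≤ y → y ≤ hi → b (0, y) = (v 0 y ^^ κ₀) := fun y h1 h2 => by
      rw [hB (0, y) ((mem_Jw lo hi 0 y).2 (Or.inl ⟨rfl, h1, h2⟩)), bits_zero]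
    have hc4 : b (4, 1) = (v 1 0 ^^ v 0 0 ^^ κ₀) := by
      rw [hB (4, 1) ((mem_Jw lo hi 4 1).2 (Or.inr (Or.inl ⟨rfl, rfl⟩))), bits_four]
    have h13 : ∀ τ' : Bool, (kL τ' = 1 ∨ kL τ' = 2 ∨ kL τ' = 3) ∧ (kR τ' = 1 ∨ kR τ' = 2 ∨ kR τ' = 3) := by decide
    have hbL : ∀ s, lo ≤ s → s < hi → b (kL τ, s) = oL v s := fun s h1 h2 => by
      rw [hB (kL τ, s) ((mem_Jw lo hi _ s).2 (Or.inr (Or.inr ⟨(h13 τ).1, h1, h2⟩))), bits_kL]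
    have hbR : ∀ s, lo ≤ s → s < hi → b (kR τ, s) = oR v s := fun s h1 h2 => by
      rw [hB (kR τ, s) ((mem_Jw lo hi _ s).2 (Or.inr (Or.inr ⟨(h13 τ).2, h1, h2⟩))), bits_kR]
    have hcoin : ∀ s, lo ≤ s → s < hi → b (2, s) = α (isoJ τ) s := fun s h1 h2 => by
      rw [hB (2, s) ((mem_Jw lo hi 2 s).2 (Or.inr (Or.inr ⟨Or.inr (Or.inl rfl), h1, h2⟩))), bits_two]
    have hL := bp_tele (fun s => b (kL τ, s)) (fun s => v 0 s ^^ v 1 s) lo hi hlo hhi (fun s h1 h2 => by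
      rw [hbL s h1 h2]; simp only [oL]
      cases v 0 s <;> cases v 1 s <;> cases v 0 (s + 1) <;> cases v 1 (s + 1) <;> decide)
    have hR := bp_tele (fun s => b (kR τ, s)) (fun s => v 1 s ^^ v 2 s) lo hi hlo hhi (fun s h1 h2 => by
      rw [hbR s h1 h2]; simp only [oR]
      cases v 1 s <;> cases v 2 s <;> cases v 1 (s + 1) <;> cases v 2 (s + 1) <;> decide)
    refine ⟨fun j y h1 h2 => ?_, fun j y h1 h2 => ?_⟩
    · fin_cases j
      · simp only [Fin.zero_eta, col_zero, hr y h1 h2]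
        cases κ₀ <;> cases v 0 y <;> decide
      · simp only [Fin.mk_one, col_one, hc4, hr y h1 h2, hL y h1 h2]
        cases κ₀ <;> cases v 0 y <;> cases v 1 0 <;> cases v 0 0 <;> cases v 1 y <;> decide
      · simp only [Fin.reduceFinMk, col_two, hr y h1 h2]
        rw [Bool.xor_assoc (κ₂ ^^ (v 0 y ^^ κ₀)), bp_one_three τ, hL y h1 h2, hR y h1 h2]
        obtain ⟨hc0, -⟩ := hcond
        revert hc0
        cases κ₀ <;> cases κ₂ <;> cases v 0 y <;> cases v 1 0 <;> cases v 0 0 <;> cases v 1 y <;> cases v 2 0 <;>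
          cases v 2 y <;> decide
    · fin_cases j <;> cases τ
      · exact (hcond.2 y h1 h2).symm
      · exact hcoin y h1 h2
      · exact hcoin y h1 h2
      · exact (hcond.2 y h1 h2).symm

/-- THE WINDOW LAW (box form). [folklore] -/
theorem P_Wev (τ κ₀ κ₂ : Bool) {lo hi : ℤ} (hlo : lo ≤ 0) (hhi : 0 ≤ hi) (v : Fin 3 → ℤ → Bool)
    (α : Fin 2 → ℤ → Bool) :
    P (Wev τ κ₀ κ₂ lo hi v α) =
      if (v 0 0 ^^ v 2 0) = (κ₀ ^^ κ₂) ∧ (∀ y, lo ≤ y → y < hi → α (hcJ τ) y = true)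
      then ∏ j ∈ Jw lo hi, ENNReal.ofReal (if bits τ κ₀ v α j then (wt j.1 : ℝ) else 1 - wt j.1) else 0 := by
  rw [Wev_eq τ κ₀ κ₂ hlo hhi v α]
  split_ifs
  · exact P_pi _ _
  · exact measure_empty

end SDE

/-- WINDOW LAW of the explicit strip model (part 1 of `stub_StripDiagramExchange`): the probability that the
strip configuration on the rows `[lo, hi] ∋ 0` is a given pattern is the product of the Bernoulli masses of
the unique bit assignment producing it (zero unless the anchor constraint and the honeycomb flags hold). [folklore] -/
theorem stripDX_windowLaw : ∀ (τ κ₀ κ₂ : Bool) (lo hi : ℤ), lo ≤ 0 → 0 ≤ hi → ∀ (v : Fin 3 → ℤ → Bool) (α : Fin 2 → ℤ → Bool), SDE.P (SDE.Wev τ κ₀ κ₂ lo hi v α) = if (v 0 0 ^^ v 2 0) = (κ₀ ^^ κ₂) ∧ (∀ y, lo ≤ y → y < hi → α (SDE.hcJ τ) y = true) then ∏ j ∈ SDE.Jw lo hi, ENNReal.ofReal (if SDE.bits τ κ₀ v α j then (SDE.wt j.1 : ℝ) else 1 - SDE.wt j.1) else 0 :=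
  fun τ κ₀ κ₂ _ _ hlo hhi v α => SDE.P_Wev τ κ₀ κ₂ hlo hhi v α

end Summit.CriticalPhenomena.CardyFormulaZ2.Theorems.IKLinearTransport.PinnedDiagramExchange
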